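import Literature.Probability.Percolation.BoundaryExplorerInterface
import Literature.Probability.Percolation.ColourSwitching
import HarnessLib

/-!
# The boundary-interface exploration from arbitrary seeds (Schramm–Smirnov's interfaces from `β`)

Topic `Literature/Probability/Percolation`; definitions-and-proofs support file (no named fact)
for the mesh-independent gluing Proposition 4.1 of O. Schramm, S. Smirnov, *On the scaling limits
of planar percolation*, Ann. Probab. 39 (2011), arXiv:1101.5820, §4 ("Bays and beaches", p. 18):

> "In what follows, we start on the curve `β` and explore all the potential crossings of the strip
> between `β` and `β'`. … Let `I` be the set of connected components of the intersection of `∂ω̃`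
> with the interior of `K` (i.e., percolation interface in the interior of `K`), and let `Ĩ`
> denote the set of elements of `I` that have at least one endpoint on `β`. … Let `M'` be the
> union of the component of `[Q₀] ∖ β'` containing `α`, and of all the bays without beaches.
> Denote by `M` the complement … The following property of `M` is essential: given `M` and the
> restriction of `ω` to it, the conditional law of the restriction of `ω` to `M'` is unbiased. …
> This follows directly from the fact that `M(ω₂) = M(ω)`."

For bond percolation on `ℤ²` the interfaces starting on `β` are followed by the closure procedure
of the tree's boundary-interface explorer (`BoundaryExplorer.lean`, van den Berg–Nolin's `Γ` in a
box, seeds = the sphere and the outer faces).  This file is that explorer with ARBITRARY SEEDS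
`𝔖 = (A, O₀, D₀)`: a finite set `A` of examinable lattice edges (the edges of the strip `K` and its
legs), a set `O₀` of seed sites (the far side, already explored) and a set `D₀` of seed faces (the
faces touching the far side):

* `Seeded.OReach 𝔖 X ω v` (`𝒪`): `v` is joined to a seed site through examined edges (`X`) open in
  `ω`; `Seeded.DReach 𝔖 X ω f` (`𝒟`): the face `f` is joined to a seed face across examined
  lattice edges closed in `ω`; `Seeded.Eligible`: an unexamined edge of `A` with an endpoint in `𝒪`
  and a face in `𝒟` ("on an interface between a boundary cluster and the boundary dual cluster");
  `Seeded.explorer 𝔖` probes an eligible edge while there is one.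
* Mechanics (verbatim from the box case): freshness (`explorer_fresh`), truthfulness of the
  records, only edges of `A` are examined (`supp_hist_subset`), the two-arm property of examined
  edges (`oReach_and_dReach_of_mem_supp_hist`), termination by time `termTime 𝔖 = |A| + 1`
  (`next_hist_termTime`), and the terminal data `Seeded.IsTerminal` with its first consequences:
  examined open edges have both endpoints in `𝒪`, examined closed edges both faces in `𝒟`, an
  unexamined edge of `A` with an endpoint in `𝒪` has no face in `𝒟` (`IsTerminal.oReach_of_mem`,
  `.dReach_of_mem`, `.not_dReach_of_not_mem`).
* **The explored set is a stopping set** (`isStoppingSet_examined`: "`M(ω₂) = M(ω)`", from the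
  no-look-ahead property `Explorer.hist_eq_of_agree`), with values in `A`
  (`examined_subset`), so that the conditioning calculus of `StoppingSetCondExp.lean` applies to
  the data `(examined edges, their states)`.

## References

* O. Schramm, S. Smirnov, Ann. Probab. 39 (2011) 1768–1814, arXiv:1101.5820, §4, proof of
  Prop. 4.1 ("Bays and beaches"). [SchrammSmirnov2011]
* J. van den Berg, P. Nolin, Progr. Probab. 77 (2020) = arXiv:2008.01606, §5.2 (the exploration
  procedure `Γ`). [VandenbergNolin2020]
* B. Bollobás, O. Riordan, *Percolation*, CUP (2006), Ch. 7, proof of Lemma 6, p. 175 (stopping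
  sets). [BollobasRiordan2006]

Tree: `Explorer`, `Explorer.hist`, `Explorer.Fresh`, `Explorer.hist_eq_of_agree`,
`Explorer.supp_hist_succ_of_some/none`, `Explorer.supp_hist_mono`, `ProbeHistory.supp`, `obs`
(`SequentialProbing.lean`, `RevealmentOrthogonality.lean`); `openSupp` and its calculus,
`reflTransGen_of_imp` (`BoundaryExplorer.lean`); `IsFaceOf`, `dualEdge`, `exists_dualEdge_eq_of_isFaceOf`,
`isFaceOf_iff_of_dualEdge_eq` (`LatticeFaceParity.lean`); `IsStoppingSet` (`ColourSwitching.lean`).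
-/

noncomputable section

namespace Literature.Probability.Percolation

open LatticeModels Relation ProbeHistory
open scoped Classical

namespace Seeded

/-! ### Seeds -/

/-- **Seeds of a boundary-interface exploration**: the examinable lattice edges `A` (finite), the
seed sites `O₀` (already joined to the far side) and the seed faces `D₀`.
[cite: SchrammSmirnov2011, §4, proof of Prop. 4.1 ("we start on the curve β")] -/
structure Seeds where
  /-- the examinable edges -/
  A : Finset (Sym2 (Site 2))
  /-- the seed sites of `𝒪` -/
  O₀ : Set (Site 2)
  /-- the seed faces of `𝒟` (lower-left corners) -/
  D₀ : Set (Site 2)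
  /-- examinable edges are lattice edges -/
  A_subset : ∀ e ∈ A, e ∈ (zdGraph 2).edgeSet

variable (𝔖 : Seeds)

/-! ### The explored clusters `𝒪`, `𝒟` and eligibility -/

/-- **`𝒪`**: the sites joined to a seed site through edges of `X` open in `ω`.
[cite: SchrammSmirnov2011, §4 (interfaces with an endpoint on β: their open side)] -/
def OReach (X : Finset (Sym2 (Site 2))) (ω : BondConfig (Site 2)) (v : Site 2) : Prop :=
  ∃ s ∈ 𝔖.O₀, ReflTransGen (fun x y => s(x, y) ∈ X ∧ s(x, y) ∈ ω) s v

/-- **`𝒟`**: the faces joined to a seed face across lattice edges of `X` closed in `ω`.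
[cite: SchrammSmirnov2011, §4 (interfaces with an endpoint on β: their closed side)] -/
def DReach (X : Finset (Sym2 (Site 2))) (ω : BondConfig (Site 2)) (f : Site 2) : Prop :=
  ∃ g ∈ 𝔖.D₀, ReflTransGen (fun a b => ∃ e ∈ X, e ∉ ω ∧ e ∈ (zdGraph 2).edgeSet ∧ dualEdge e = s(a, b)) g f

/-- **Eligible edges**: an unexamined examinable edge with an endpoint in `𝒪` and a face in `𝒟`.
[cite: VandenbergNolin2020, §5.2 (the exploration follows the boundaries of the clusters)] -/
def Eligible (X : Finset (Sym2 (Site 2))) (ω : BondConfig (Site 2)) (e : Sym2 (Site 2)) : Prop :=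
  e ∈ 𝔖.A ∧ e ∉ X ∧ (∃ v ∈ e, OReach 𝔖 X ω v) ∧ ∃ f : Site 2, IsFaceOf f e ∧ DReach 𝔖 X ω f

variable {𝔖}

/-- Seed sites are in `𝒪`. [folklore] -/
theorem oReach_of_mem_seeds (X : Finset (Sym2 (Site 2))) (ω : BondConfig (Site 2)) {v : Site 2}
    (hv : v ∈ 𝔖.O₀) : OReach 𝔖 X ω v :=
  ⟨v, hv, ReflTransGen.refl⟩

/-- Seed faces are in `𝒟`. [folklore] -/
theorem dReach_of_mem_seeds (X : Finset (Sym2 (Site 2))) (ω : BondConfig (Site 2)) {f : Site 2}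
    (hf : f ∈ 𝔖.D₀) : DReach 𝔖 X ω f :=
  ⟨f, hf, ReflTransGen.refl⟩

/-- `𝒪` is closed under open edges of `X`. [folklore] -/
theorem OReach.step {X : Finset (Sym2 (Site 2))} {ω : BondConfig (Site 2)} {x y : Site 2}
    (hx : OReach 𝔖 X ω x) (hX : s(x, y) ∈ X) (hω : s(x, y) ∈ ω) : OReach 𝔖 X ω y := by
  obtain ⟨s, hs, h⟩ := hx
  exact ⟨s, hs, h.tail ⟨hX, hω⟩⟩

/-- `𝒟` is closed under closed lattice edges of `X`. [folklore] -/
theorem DReach.step {X : Finset (Sym2 (Site 2))} {ω : BondConfig (Site 2)} {a b : Site 2}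
    (ha : DReach 𝔖 X ω a) {e : Sym2 (Site 2)} (hX : e ∈ X) (hω : e ∉ ω)
    (he : e ∈ (zdGraph 2).edgeSet) (hd : dualEdge e = s(a, b)) : DReach 𝔖 X ω b := by
  obtain ⟨g, hg, h⟩ := ha
  exact ⟨g, hg, h.tail ⟨e, hX, hω, he, hd⟩⟩

/-- `𝒪` grows with `X`. [folklore] -/
theorem OReach.mono {X X' : Finset (Sym2 (Site 2))} (hXX' : X ⊆ X') {ω : BondConfig (Site 2)}
    {v : Site 2} (h : OReach 𝔖 X ω v) : OReach 𝔖 X' ω v := by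
  obtain ⟨s, hs, h⟩ := h
  exact ⟨s, hs, reflTransGen_of_imp (fun x y hxy => ⟨hXX' hxy.1, hxy.2⟩) h⟩

/-- `𝒟` grows with `X`. [folklore] -/
theorem DReach.mono {X X' : Finset (Sym2 (Site 2))} (hXX' : X ⊆ X') {ω : BondConfig (Site 2)}
    {f : Site 2} (h : DReach 𝔖 X ω f) : DReach 𝔖 X' ω f := by
  obtain ⟨g, hg, h⟩ := h
  exact ⟨g, hg, reflTransGen_of_imp (fun a b ⟨e, he, h1, h2, h3⟩ => ⟨e, hXX' he, h1, h2, h3⟩) h⟩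

/-- `𝒪` only reads `ω` on `X`. [folklore] -/
theorem oReach_congr {X : Finset (Sym2 (Site 2))} {ω ω' : BondConfig (Site 2)}
    (h : ∀ e ∈ X, (e ∈ ω ↔ e ∈ ω')) (v : Site 2) : OReach 𝔖 X ω v ↔ OReach 𝔖 X ω' v := by
  unfold OReach
  refine exists_congr fun s => and_congr_right fun _ => ?_
  have key : ∀ x y : Site 2, (s(x, y) ∈ X ∧ s(x, y) ∈ ω) ↔ (s(x, y) ∈ X ∧ s(x, y) ∈ ω') :=
    fun x y => ⟨fun hh => ⟨hh.1, (h _ hh.1).1 hh.2⟩, fun hh => ⟨hh.1, (h _ hh.1).2 hh.2⟩⟩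
  constructor
  · exact fun hr => reflTransGen_of_imp (fun x y hxy => (key x y).1 hxy) hr
  · exact fun hr => reflTransGen_of_imp (fun x y hxy => (key x y).2 hxy) hr

/-- `𝒟` only reads `ω` on `X`. [folklore] -/
theorem dReach_congr {X : Finset (Sym2 (Site 2))} {ω ω' : BondConfig (Site 2)}
    (h : ∀ e ∈ X, (e ∈ ω ↔ e ∈ ω')) (f : Site 2) : DReach 𝔖 X ω f ↔ DReach 𝔖 X ω' f := by
  unfold DReach
  refine exists_congr fun g => and_congr_right fun _ => ?_
  constructor
  · exact fun hr => reflTransGen_of_imp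
      (fun a b ⟨e, he, h1, h2, h3⟩ => ⟨e, he, fun h' => h1 ((h e he).2 h'), h2, h3⟩) hr
  · exact fun hr => reflTransGen_of_imp
      (fun a b ⟨e, he, h1, h2, h3⟩ => ⟨e, he, fun h' => h1 ((h e he).1 h'), h2, h3⟩) hr

/-- Eligibility only reads `ω` on `X`. [folklore] -/
theorem eligible_congr {X : Finset (Sym2 (Site 2))} {ω ω' : BondConfig (Site 2)}
    (h : ∀ e ∈ X, (e ∈ ω ↔ e ∈ ω')) (e : Sym2 (Site 2)) : Eligible 𝔖 X ω e ↔ Eligible 𝔖 X ω' e := by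
  unfold Eligible
  simp only [oReach_congr h, dReach_congr h]

/-! ### The explorer -/

variable (𝔖)

/-- **The seeded boundary-interface explorer**: probe some eligible edge if there is one, else
stop. [cite: SchrammSmirnov2011, §4, proof of Prop. 4.1 ("explore all the potential crossings of the strip")] -/
def explorer : Explorer (Site 2) where
  next h :=
    if hex : ∃ e, Eligible 𝔖 (supp h) (↑(openSupp h) : Set (Sym2 (Site 2))) e then some {hex.choose}
    else none

variable {𝔖}

/-- What a probe of the explorer is: a single eligible edge. [folklore] -/
theorem explorer_next_eq_some {h : ProbeHistory (Site 2)} {D : Finset (Sym2 (Site 2))}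
    (hD : (explorer 𝔖).next h = some D) :
    ∃ e, D = {e} ∧ Eligible 𝔖 (supp h) (↑(openSupp h) : Set (Sym2 (Site 2))) e := by
  unfold explorer at hD
  simp only at hD
  split_ifs at hD with hex
  rw [Option.some.injEq] at hD
  exact ⟨hex.choose, hD.symm, hex.choose_spec⟩

/-- The explorer stops exactly when no edge is eligible. [folklore] -/
theorem explorer_next_eq_none_iff {h : ProbeHistory (Site 2)} :
    (explorer 𝔖).next h = none ↔
      ∀ e, ¬ Eligible 𝔖 (supp h) (↑(openSupp h) : Set (Sym2 (Site 2))) e := by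
  unfold explorer
  simp only
  by_cases hex : ∃ e, Eligible 𝔖 (supp h) (↑(openSupp h) : Set (Sym2 (Site 2))) e
  · rw [dif_pos hex]
    refine ⟨fun h0 => ?_, fun h0 => (h0 _ hex.choose_spec).elim⟩
    cases h0
  · rw [dif_neg hex]
    exact ⟨fun _ e he => hex ⟨e, he⟩, fun _ => rfl⟩

variable (𝔖) in
/-- **No edge is probed twice**: eligible edges are unexamined. [cite: VandenbergNolin2020, §5.2 ("each time it reaches a fresh vertex")] -/
theorem explorer_fresh : (explorer 𝔖).Fresh ∅ := by
  intro h D hD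
  obtain ⟨e, rfl, he⟩ := explorer_next_eq_some hD
  refine ⟨Finset.disjoint_coe.2 (Finset.disjoint_empty_right _) |>.mono_right (by simp), ?_⟩
  rw [Finset.disjoint_singleton_left]
  exact he.2.1

/-! ### The run on a configuration -/

section Run

variable (𝔖) (ω : BondConfig (Site 2))

/-- **Truthfulness of the records**: the recorded open edges after `t` steps are the examined
edges that are open in `ω`. [folklore] -/
theorem mem_openSupp_hist_iff' (t : ℕ) (e : Sym2 (Site 2)) :
    e ∈ openSupp ((explorer 𝔖).hist t ω) ↔ e ∈ supp ((explorer 𝔖).hist t ω) ∧ e ∈ ω := by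
  induction t with
  | zero => simp
  | succ t ih =>
    rw [Explorer.hist_succ]
    cases hD : (explorer 𝔖).next ((explorer 𝔖).hist t ω) with
    | none => rw [Explorer.step_of_none _ hD, openSupp_cons_none, supp_cons_none, ih]
    | some D =>
      rw [Explorer.step_of_some _ hD, mem_openSupp_cons_some_iff, mem_supp_cons_some_iff, ih, mem_obs_iff]
      tauto

/-- The explored clusters computed from the records are those computed from `ω`. [folklore] -/
theorem mem_openSupp_hist_iff (t : ℕ) {e : Sym2 (Site 2)} (he : e ∈ supp ((explorer 𝔖).hist t ω)) :
    e ∈ (↑(openSupp ((explorer 𝔖).hist t ω)) : Set (Sym2 (Site 2))) ↔ e ∈ ω := by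
  rw [Finset.mem_coe, mem_openSupp_hist_iff']
  exact ⟨fun h => h.2, fun h => ⟨he, h⟩⟩

/-- Eligibility with respect to the records is eligibility with respect to `ω`. [folklore] -/
theorem eligible_hist_iff (t : ℕ) (e : Sym2 (Site 2)) :
    Eligible 𝔖 (supp ((explorer 𝔖).hist t ω)) (↑(openSupp ((explorer 𝔖).hist t ω))) e ↔
      Eligible 𝔖 (supp ((explorer 𝔖).hist t ω)) ω e :=
  eligible_congr (fun _ he' => mem_openSupp_hist_iff 𝔖 ω t he') e

/-- **The probe made at time `t` is a single edge, eligible for `ω`.** [folklore] -/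
theorem exists_eq_singleton_of_next_hist {t : ℕ} {D : Finset (Sym2 (Site 2))}
    (hD : (explorer 𝔖).next ((explorer 𝔖).hist t ω) = some D) :
    ∃ e, D = {e} ∧ Eligible 𝔖 (supp ((explorer 𝔖).hist t ω)) ω e := by
  obtain ⟨e, rfl, he⟩ := explorer_next_eq_some hD
  exact ⟨e, rfl, (eligible_hist_iff 𝔖 ω t e).1 he⟩

/-- **Only examinable edges are examined.** [folklore] -/
theorem supp_hist_subset (t : ℕ) : supp ((explorer 𝔖).hist t ω) ⊆ 𝔖.A := by
  induction t with
  | zero => simp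
  | succ t ih =>
    cases hD : (explorer 𝔖).next ((explorer 𝔖).hist t ω) with
    | none => rw [Explorer.supp_hist_succ_of_none _ hD]; exact ih
    | some D =>
      obtain ⟨e, rfl, he⟩ := exists_eq_singleton_of_next_hist 𝔖 ω hD
      intro x hx
      rw [Explorer.mem_supp_hist_succ_iff_of_some _ hD, Finset.mem_singleton] at hx
      rcases hx with rfl | hx
      · exact he.1
      · exact ih hx

/-- **The two-arm property of examined edges**: every examined edge has an endpoint in `𝒪` and a
face in `𝒟`. [cite: VandenbergNolin2020, §5.2 (the two arms of an explored vertex)] -/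
theorem oReach_and_dReach_of_mem_supp_hist (t : ℕ) {e : Sym2 (Site 2)}
    (he : e ∈ supp ((explorer 𝔖).hist t ω)) :
    (∃ v ∈ e, OReach 𝔖 (supp ((explorer 𝔖).hist t ω)) ω v) ∧
      ∃ f : Site 2, IsFaceOf f e ∧ DReach 𝔖 (supp ((explorer 𝔖).hist t ω)) ω f := by
  induction t with
  | zero => simp at he
  | succ t ih =>
    have hmono : supp ((explorer 𝔖).hist t ω) ⊆ supp ((explorer 𝔖).hist (t + 1) ω) :=
      Explorer.supp_hist_mono _ (Nat.le_succ t) ω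
    have hold : e ∈ supp ((explorer 𝔖).hist t ω) →
        (∃ v ∈ e, OReach 𝔖 (supp ((explorer 𝔖).hist (t + 1) ω)) ω v) ∧
          ∃ f : Site 2, IsFaceOf f e ∧ DReach 𝔖 (supp ((explorer 𝔖).hist (t + 1) ω)) ω f := by
      intro he'
      obtain ⟨⟨v, hv, hO⟩, ⟨f, hf, hDr⟩⟩ := ih he'
      exact ⟨⟨v, hv, hO.mono hmono⟩, ⟨f, hf, hDr.mono hmono⟩⟩
    cases hD : (explorer 𝔖).next ((explorer 𝔖).hist t ω) with
    | none =>
      rw [Explorer.supp_hist_succ_of_none _ hD] at he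
      exact hold he
    | some D =>
      rw [Explorer.mem_supp_hist_succ_iff_of_some _ hD] at he
      rcases he with he | he
      · obtain ⟨e₀, he₀, he'⟩ := exists_eq_singleton_of_next_hist 𝔖 ω hD
        rw [he₀, Finset.mem_singleton] at he
        subst he
        obtain ⟨-, -, ⟨v, hv, hO⟩, ⟨f, hf, hDr⟩⟩ := he'
        exact ⟨⟨v, hv, hO.mono hmono⟩, ⟨f, hf, hDr.mono hmono⟩⟩
      · exact hold he

/-! ### Termination -/

/-- Once the explorer stops it stays stopped. [folklore] -/
theorem next_hist_succ_eq_none {t : ℕ}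
    (h : (explorer 𝔖).next ((explorer 𝔖).hist t ω) = none) :
    (explorer 𝔖).next ((explorer 𝔖).hist (t + 1) ω) = none := by
  have hs : supp ((explorer 𝔖).hist (t + 1) ω) = supp ((explorer 𝔖).hist t ω) :=
    Explorer.supp_hist_succ_of_none _ h
  have ho : openSupp ((explorer 𝔖).hist (t + 1) ω) = openSupp ((explorer 𝔖).hist t ω) := by
    rw [Explorer.hist_succ, Explorer.step_of_none _ h, openSupp_cons_none]
  rw [explorer_next_eq_none_iff, hs, ho]
  exact explorer_next_eq_none_iff.1 h

/-- Once stopped, stopped at all later times. [folklore] -/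
theorem next_hist_eq_none_of_le {t t' : ℕ} (htt' : t ≤ t')
    (h : (explorer 𝔖).next ((explorer 𝔖).hist t ω) = none) :
    (explorer 𝔖).next ((explorer 𝔖).hist t' ω) = none := by
  induction htt' with
  | refl => exact h
  | step _ ih => exact next_hist_succ_eq_none 𝔖 ω ih

/-- While the explorer has not stopped, the number of examined edges is at least the time.
[folklore] -/
theorem le_card_supp_hist {t : ℕ} (h : (explorer 𝔖).next ((explorer 𝔖).hist t ω) ≠ none) :
    t ≤ (supp ((explorer 𝔖).hist t ω)).card := by
  induction t with
  | zero => exact Nat.zero_le _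
  | succ t ih =>
    have ht : (explorer 𝔖).next ((explorer 𝔖).hist t ω) ≠ none := fun h0 =>
      h (next_hist_succ_eq_none 𝔖 ω h0)
    obtain ⟨D, hD⟩ := Option.ne_none_iff_exists'.1 ht
    obtain ⟨e, rfl, he⟩ := exists_eq_singleton_of_next_hist 𝔖 ω hD
    rw [Explorer.card_supp_hist_succ_of_some _ hD (Finset.disjoint_singleton_left.2 he.2.1),
      Finset.card_singleton]
    have := ih ht
    omega

/-- **The termination time** `|A| + 1`. [folklore] -/
def termTime : ℕ := 𝔖.A.card + 1

/-- **Termination**: at time `termTime 𝔖` the explorer has stopped. [cite: VandenbergNolin2020, §5.2 (the exploration ends)] -/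
theorem next_hist_termTime : (explorer 𝔖).next ((explorer 𝔖).hist (termTime 𝔖) ω) = none := by
  by_contra h
  have h1 := le_card_supp_hist 𝔖 ω h
  have h2 : (supp ((explorer 𝔖).hist (termTime 𝔖) ω)).card ≤ 𝔖.A.card :=
    Finset.card_le_card (supp_hist_subset 𝔖 ω _)
  unfold termTime at h1 h2
  omega

/-- **At termination no edge is eligible** (for the configuration `ω` itself). [folklore] -/
theorem not_eligible_termTime (e : Sym2 (Site 2)) :
    ¬ Eligible 𝔖 (supp ((explorer 𝔖).hist (termTime 𝔖) ω)) ω e := by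
  have h := explorer_next_eq_none_iff.1 (next_hist_termTime 𝔖 ω) e
  rwa [eligible_hist_iff] at h

end Run

/-! ### The examined set: a stopping set with values in `A` -/

variable (𝔖)

/-- **The explored (examined) edges of `ω`**: the support of the history at termination — the
random set `X(ω)` of edges examined by the interface exploration (Schramm–Smirnov's `M ∩ K`, up to
the far side which is explored wholesale). [cite: SchrammSmirnov2011, §4, proof of Prop. 4.1 (the set M)] -/
def examined (ω : BondConfig (Site 2)) : Finset (Sym2 (Site 2)) :=
  supp ((explorer 𝔖).hist (termTime 𝔖) ω)

variable {𝔖}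

/-- Examined edges are examinable. [folklore] -/
theorem examined_subset (ω : BondConfig (Site 2)) : examined 𝔖 ω ⊆ 𝔖.A :=
  supp_hist_subset 𝔖 ω _

/-- **The examined set is a stopping set**: configurations agreeing on the examined edges of `ω`
have the same examined edges ("`M(ω₂) = M(ω)`"; no look-ahead, `Explorer.hist_eq_of_agree`).
[cite: SchrammSmirnov2011, §4, proof of Prop. 4.1 ("This follows directly from the fact that M(ω₂) = M(ω)")] -/
theorem isStoppingSet_examined : IsStoppingSet (examined 𝔖) := by
  intro ω ω' hag
  unfold examined at hag ⊢
  rw [(explorer 𝔖).hist_eq_of_agree hag rfl]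

/-- The whole terminal history is determined by the examined edges and their states.
[folklore] -/
theorem hist_termTime_eq_of_agree {ω ω' : BondConfig (Site 2)}
    (hag : ∀ e ∈ examined 𝔖 ω, (e ∈ ω ↔ e ∈ ω')) :
    (explorer 𝔖).hist (termTime 𝔖) ω' = (explorer 𝔖).hist (termTime 𝔖) ω :=
  (explorer 𝔖).hist_eq_of_agree hag rfl

/-! ### The terminal data and its first consequences -/

variable (𝔖)

/-- **Hypotheses on terminal data** `(X, ω)`: examined edges are examinable, every examined edge
has an endpoint in `𝒪` and a face in `𝒟`, and no edge is eligible. [folklore] -/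
structure IsTerminal (X : Finset (Sym2 (Site 2))) (ω : BondConfig (Site 2)) : Prop where
  subset : X ⊆ 𝔖.A
  two_arms : ∀ e ∈ X, (∃ v ∈ e, OReach 𝔖 X ω v) ∧ ∃ f : Site 2, IsFaceOf f e ∧ DReach 𝔖 X ω f
  not_eligible : ∀ e, ¬ Eligible 𝔖 X ω e

variable {𝔖}

/-- **The examined set of `ω` is terminal data for `ω`.** [folklore] -/
theorem isTerminal_examined (ω : BondConfig (Site 2)) : IsTerminal 𝔖 (examined 𝔖 ω) ω :=
  ⟨examined_subset ω, fun _ he => oReach_and_dReach_of_mem_supp_hist 𝔖 ω _ he,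
    not_eligible_termTime 𝔖 ω⟩

section Terminal

variable {X : Finset (Sym2 (Site 2))} {ω : BondConfig (Site 2)} (hT : IsTerminal 𝔖 X ω)
include hT

/-- **Examined open edges have both endpoints in `𝒪`.** [folklore] -/
theorem IsTerminal.oReach_of_mem {e : Sym2 (Site 2)} (heX : e ∈ X) (heω : e ∈ ω) {v : Site 2}
    (hv : v ∈ e) : OReach 𝔖 X ω v := by
  obtain ⟨⟨u, hu, hO⟩, -⟩ := hT.two_arms e heX
  by_cases huv : u = v
  · exact huv ▸ hO
  · have he : e = s(u, v) := (Sym2.mem_and_mem_iff huv).1 ⟨hu, hv⟩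
    subst he
    exact hO.step heX heω

/-- **Examined closed edges have both faces in `𝒟`.** [folklore] -/
theorem IsTerminal.dReach_of_mem {e : Sym2 (Site 2)} (heX : e ∈ X) (heω : e ∉ ω) {f : Site 2}
    (hf : IsFaceOf f e) : DReach 𝔖 X ω f := by
  obtain ⟨-, ⟨f₀, hf₀, hD⟩⟩ := hT.two_arms e heX
  have he := 𝔖.A_subset e (hT.subset heX)
  obtain ⟨g, -, hd⟩ := exists_dualEdge_eq_of_isFaceOf he hf₀
  rcases (isFaceOf_iff_of_dualEdge_eq hd).1 hf with rfl | rfl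
  · exact hD
  · exact hD.step heX heω he hd

/-- **Every examined edge has a face in `𝒟`.** [folklore] -/
theorem IsTerminal.exists_isFaceOf_dReach {e : Sym2 (Site 2)} (heX : e ∈ X) :
    ∃ f : Site 2, IsFaceOf f e ∧ DReach 𝔖 X ω f :=
  (hT.two_arms e heX).2

/-- **Termination, unpacked**: an unexamined examinable edge with an endpoint in `𝒪` has no face
in `𝒟`. [folklore] -/
theorem IsTerminal.not_dReach_of_not_mem {e : Sym2 (Site 2)} (he : e ∈ 𝔖.A) (heX : e ∉ X)
    {v : Site 2} (hv : v ∈ e) (hO : OReach 𝔖 X ω v) {f : Site 2} (hf : IsFaceOf f e) :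
    ¬ DReach 𝔖 X ω f :=
  fun hD => hT.not_eligible e ⟨he, heX, ⟨v, hv, hO⟩, ⟨f, hf, hD⟩⟩

omit hT in
/-- **`𝒪` beyond the seeds consists of endpoints of examined open edges.** [folklore] -/
theorem exists_mem_of_oReach {v : Site 2} (hv : OReach 𝔖 X ω v) :
    v ∈ 𝔖.O₀ ∨ ∃ e ∈ X, e ∈ ω ∧ v ∈ e := by
  obtain ⟨s, hs, h⟩ := hv
  induction h with
  | refl => exact Or.inl hs
  | @tail x y _ hxy _ => exact Or.inr ⟨_, hxy.1, hxy.2, Sym2.mem_mk_right x y⟩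

end Terminal

end Seeded

end Literature.Probability.Percolation
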